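import Literature.MathematicalPhysics.QuantumFieldTheory.Balaban1983to89.B13TermWalkDataOneTorus

/-!
# `Balaban1983to89.NodeOLetters` — NODE O's `TermWalkData` ∕ `ExistsUniformAcrossSmall` (B13TermWalkDataOneTorus :353)
# INHABITED FROM FIVE ENTRYWISE LETTER FAMILIES at complex background (the walk-free interface theorem)

Cell `ym-nodeO-ideate` (portfolio track; operator priority5, 2026-08-25), lens P2 «around Bałaban», memo `ROUTE-P2.md` v3.10,
census section S25, typed candidates T-25.1 – T-25.5.  LANDING EDITION of the companion `ROUTE-P2-files/SketchLetters.lean`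
(sha256 97ed61a8…; referee REF g18 PASS 2026-08-25T17:37:59Z, ROUND VERDICT 17:50:10Z name (1); director line №2 (B)):
statements and proofs character-identical to the frozen companion; edition deltas = the namespace, this header paragraph, the
WHAT-THIS-IS-NOT paragraph, cite-tag guards (LIT SOURCES v2.75 §6; n33 `(3.93) p.411 → p.410`), and docstrings on six
unfolding lemmas, four bookkeeping definitions and two one-bond lemmas.

**THE INTERFACE THEOREM.**  NODE O's type never asks for walks.  The three `∃`-packaged objects of
`B13TermWalkData.TermWalkData 𝒦 w` (joint walk expansions of the Γ-kernel `𝒦.G2` and of the precision `𝒦.A2` with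
σ-structure through `𝒦.X`, walk majorants of the covariance `(𝒦.A2 σ u)⁻¹`) are INHABITED by a TWO-TERM packaging
(`W = Bool`: the σ-free term `K(σ,u) − K(σ,0) + K(0,0)` and the σ-carrying, `u`-free term `K(σ,0) − K(0,0)` routed
THROUGH `X` by the inf-convolution distance `d_X(a,b) = min_{z ∈ X} (d₁(a,z) + d₁(z,b))`), resp. a ONE-TERM packaging,
of FIVE ENTRYWISE LETTER FAMILIES at complex background — uniformly on polydisc `‖σ_j‖ ≤ e^{κ₁}` × ball `‖u‖ < R`:
* (L1) plain decay `‖K(σ,u)_{ij}‖ ≤ B·e^{−ρ d₁(i,j)}` for `K ∈ {G2, A2}`;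
* (L2) σ-localisation AT THE REFERENCE CONFIGURATION through `X`: `‖(K(σ,0) − K(0,0))_{ij}‖ ≤ B′·e^{−ρ d_X(i,j)}`;
* (L3) entrywise `u`-holomorphy of `K(σ,·)` on the ball;
* (L4) plain decay of the inverse precision `‖((A2(σ,u))⁻¹)_{ij}‖ ≤ B_C·e^{−κ d₁(i,j)}`;
* (L5) the geometric clause `d₁(loc b, X) ≥ R_σ` (= `hfar`, unchanged);
with the package `w = (R, ε := ρ − κ, κ, 3B_Γ + B′_Γ, 3B_E + B′_E, B_C, R_σ)` (`termWalkData_of_letters`), and — composed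
with the tree's `B13TermWalkDataOneTorus.acrossSmall_of_decay` — uniform letters across Bałaban's exhausting family plus
the exchange inequality `2K̄(e^{−(ρ−κ)R_σ} + α∕R) ≤ θ₀` give `ExistsUniformAcrossSmall` (`acrossSmall_of_letters`).
So an ALTERNATIVE ultraviolet construction (the lens) feeds NODE O exactly if it delivers (L1)–(L5) with constants
uniform in scale, torus, domain and term, AT COMPLEX BACKGROUNDS `(σ,u)`; the census S1–S24 records, source by source,
which letter fails.  Conversely (up to constants and the mixed rate `e^{−εd_X − κd₁}` in (L2)) every `TermWalkData`
yields the letters (`JointWalkExpansion.majorants` + the (2.16) mechanism) — not re-proved here.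

HONEST FRAMING: bookkeeping over the tree's hypothesis SHAPES ([folklore]: the triangle inequality, a two-element sum);
NOTHING of Bałaban's operators is constructed or asserted; the letters for HIS `Γ_k`, `Δ^{(k)}`, `C^{(k)}` are row (D4)'s
open OBJECT-level content; NOT NODE O, NOT [B12] Thm 2, NOT continuum, NOT Clay.  Dimension-generic (`d` free).  0 sorry.

WHAT THIS IS NOT: not an inhabitant of `ExistsUniformAcrossSmall` (:353) outright — NODE O MODULO the letters (L1)–(L5) for
Bałaban's operators `Γ_k`, `Δ^{(k)}(Z₀,σ,𝐔,𝐉)`, `C^{(k)}`, which are NOT supplied here (cell books: «instance 0∕1,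
reduced-to-letters», never 1∕1); no YM-PLAN ∕ Track-B node is claimed closed; not [B12] Thm 2; no continuum, mass-gap or
Clay statement.

References: T. Bałaban, CMP 116 (1988) 1–22 [II], (1.11) p. 5, p. 13, p. 15, (2.16) p. 16; CMP 99 (1985) 389–434 [B9],
Thm 3.10 (3.107)–(3.108) p. 416.
-/

noncomputable section

namespace Literature.MathematicalPhysics.QuantumFieldTheory.Balaban1983to89.NodeOLetters

open Metric Set Finset
open Literature.MathematicalPhysics.QuantumFieldTheory.Balaban1983to89
open Literature.MathematicalPhysics.QuantumFieldTheory.Balaban1983to89.B9SectDWalk (Through MajSumLe)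
open Literature.MathematicalPhysics.QuantumFieldTheory.Balaban1983to89.B9Thm34Ext (toB6)
open Literature.MathematicalPhysics.QuantumFieldTheory.Balaban1983to89.B9Thm37GlueTorus
  (torusGeom tdist1 tdist1_nonneg tdist1_triangle)
open Literature.MathematicalPhysics.QuantumFieldTheory.Balaban1983to89.TreeLengthTorus (TPt)
open Literature.MathematicalPhysics.QuantumFieldTheory.Balaban1983to89.B5TorusCover (UT)
open Literature.MathematicalPhysics.QuantumFieldTheory.Balaban1983to89.B13JointWalkExpansion
  (JointWalkExpansion WalkMajorants)
open Literature.MathematicalPhysics.QuantumFieldTheory.Balaban1983to89.B13TermWalkData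
open Literature.MathematicalPhysics.QuantumFieldTheory.Balaban1983to89.B13TermWalkDataOneTorus

variable {d N' : ℕ} {ν : ℕ} {Nf : Fin ν → ℕ} [∀ i, NeZero (Nf i)]
variable {p n : Type}
variable {E : Type*} [NormedAddCommGroup E] [NormedSpace ℂ E]

/-! ## §1. The distance through `X` and the two-term split -/

/-- **The inf-convolution distance through `X`**: `d_X(a,b) = min_{z ∈ X} (d₁(a,z) + d₁(z,b))` (and `0` for `X = ∅`,
never used). [cite: Balaban1985BackgroundPropagators, (3.93) p.410] -/
def distX (X : Finset (UT Nf)) (a b : UT Nf) : ℝ :=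
  if h : X.Nonempty then X.inf' h (fun z => tdist1 Nf a z + tdist1 Nf z b) else 0

/-- The minimum defining `d_X` is attained at some `z ∈ X` (`X ≠ ∅`). [cite: Balaban1985BackgroundPropagators, (3.93) p.410] -/
theorem distX_eq {X : Finset (UT Nf)} (hX : X.Nonempty) (a b : UT Nf) :
    ∃ z ∈ X, distX X a b = tdist1 Nf a z + tdist1 Nf z b := by
  obtain ⟨z, hz, h⟩ := Finset.exists_mem_eq_inf' hX (fun z => tdist1 Nf a z + tdist1 Nf z b)
  exact ⟨z, hz, by rw [distX, dif_pos hX, h]⟩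

/-- `d_X ≥ 0`. [cite: Balaban1985BackgroundPropagators, (3.93) p.410] -/
theorem distX_nonneg (X : Finset (UT Nf)) (a b : UT Nf) : 0 ≤ distX X a b := by
  by_cases hX : X.Nonempty
  · obtain ⟨z, _, h⟩ := distX_eq hX a b
    rw [h]; exact add_nonneg (tdist1_nonneg a z) (tdist1_nonneg z b)
  · rw [distX, dif_neg hX]

/-- `d₁ ≤ d_X` (triangle inequality). [cite: Balaban1985BackgroundPropagators, (3.93) p.410] -/
theorem tdist1_le_distX {X : Finset (UT Nf)} (hX : X.Nonempty) (a b : UT Nf) : tdist1 Nf a b ≤ distX X a b := by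
  obtain ⟨z, _, h⟩ := distX_eq hX a b
  rw [h]; exact tdist1_triangle a z b

/-- **The two terms**: `false` ↦ the σ-FREE term `K(σ,u) − K(σ,0) + K(0,0)`; `true` ↦ the σ-CARRYING, `u`-free term
`K(σ,0) − K(0,0)`. [cite: Balaban1988RG2Cluster, (2.16) p.16] -/
def twoTerms (K : (TPt d N' → ℂ) → E → Matrix p n ℂ) : Bool → (TPt d N' → ℂ) → E → Matrix p n ℂ
  | false => fun σ u => K σ u - K σ 0 + K 0 0
  | true => fun σ _ => K σ 0 - K 0 0

/-- Amplitudes of the two terms (`3B` for the σ-free term, `B′` for the σ-carrying one). [cite: Balaban1988RG2Cluster, (1.11) p.5, (2.16) p.16] -/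
def ampl (B B' : ℝ) : Bool → ℝ
  | false => 3 * B
  | true => B'

/-- Walk distances of the two terms: `d₁` for the σ-free term, `d_X` for the σ-carrying one. [cite: Balaban1988RG2Cluster, (1.11) p.5, (2.16) p.16; Balaban1985BackgroundPropagators, (3.93) p.410] -/
def walkDist (X : Finset (UT Nf)) : Bool → UT Nf → UT Nf → ℝ
  | false => tdist1 Nf
  | true => distX X

omit [NormedSpace ℂ E] in
/-- Unfolding lemma of the two-term packaging. [cite: Balaban1988RG2Cluster, (1.11) p.5, (2.16) p.16] -/
@[simp] theorem twoTerms_false (K : (TPt d N' → ℂ) → E → Matrix p n ℂ) (σ : TPt d N' → ℂ) (u : E) :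
    twoTerms K false σ u = K σ u - K σ 0 + K 0 0 := rfl
omit [NormedSpace ℂ E] in
/-- Unfolding lemma of the two-term packaging. [cite: Balaban1988RG2Cluster, (1.11) p.5, (2.16) p.16] -/
@[simp] theorem twoTerms_true (K : (TPt d N' → ℂ) → E → Matrix p n ℂ) (σ : TPt d N' → ℂ) (u : E) :
    twoTerms K true σ u = K σ 0 - K 0 0 := rfl
/-- Unfolding lemma of the two-term packaging. [cite: Balaban1988RG2Cluster, (1.11) p.5, (2.16) p.16] -/
@[simp] theorem ampl_false (B B' : ℝ) : ampl B B' false = 3 * B := rfl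
/-- Unfolding lemma of the two-term packaging. [cite: Balaban1988RG2Cluster, (1.11) p.5, (2.16) p.16] -/
@[simp] theorem ampl_true (B B' : ℝ) : ampl B B' true = B' := rfl
/-- Unfolding lemma of the two-term packaging. [cite: Balaban1988RG2Cluster, (1.11) p.5, (2.16) p.16] -/
@[simp] theorem walkDist_false (X : Finset (UT Nf)) : walkDist X false = tdist1 Nf := rfl
/-- Unfolding lemma of the two-term packaging. [cite: Balaban1988RG2Cluster, (1.11) p.5, (2.16) p.16] -/
@[simp] theorem walkDist_true (X : Finset (UT Nf)) : walkDist X true = distX X := rfl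

/-! ## §2. The letters and the interface theorem for one kernel family -/

/-- **LETTERS (L1)–(L3) of a kernel family `K(σ,u)` at complex background** (named hypothesis shape): plain decay at rate
`ρ` uniformly on polydisc × ball, σ-localisation through `X` at the reference configuration, entrywise `u`-holomorphy.
[cite: Balaban1988RG2Cluster, (1.11) p.5, p.13, p.15; Balaban1985BackgroundPropagators, (3.108) p.416] -/
structure KernelLetters (c : B13.Consts) (locp : p → UT Nf) (locn : n → UT Nf) (K : (TPt d N' → ℂ) → E → Matrix p n ℂ)
    (X : Finset (UT Nf)) (R ρ B B' : ℝ) : Prop where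
  decay : ∀ σ : TPt d N' → ℂ, (∀ j, ‖σ j‖ ≤ Real.exp c.κ₁) → ∀ u ∈ ball (0 : E) R,
    ∀ i j, ‖K σ u i j‖ ≤ B * Real.exp (-(ρ * tdist1 Nf (locp i) (locn j)))
  sigmaLoc : ∀ σ : TPt d N' → ℂ, (∀ j, ‖σ j‖ ≤ Real.exp c.κ₁) →
    ∀ i j, ‖K σ 0 i j - K 0 0 i j‖ ≤ B' * Real.exp (-(ρ * distX X (locp i) (locn j)))
  holo : ∀ σ : TPt d N' → ℂ, (∀ j, ‖σ j‖ ≤ Real.exp c.κ₁) →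
    ∀ i j, DifferentiableOn ℂ (fun u => K σ u i j) (ball (0 : E) R)
  B_nonneg : 0 ≤ B
  B'_nonneg : 0 ≤ B'

omit [∀ i, NeZero (Nf i)] in
/-- `σ = 0` lies in the polydisc `‖σ_j‖ ≤ e^{κ₁}` (private helper). [folklore] -/
private theorem zero_mem_polydisc (c : B13.Consts) : ∀ j, ‖(0 : TPt d N' → ℂ) j‖ ≤ Real.exp c.κ₁ :=
  fun _ => by simpa using (Real.exp_pos c.κ₁).le

/-- **T-25.1 — THE INTERFACE THEOREM (Γ-kernel ∕ precision slot)**: letters (L1)–(L3) at rate `ρ = κ + ε` (`κ ≥ 0`,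
`ε` of either sign at this level, `X ≠ ∅`) ⟹ a `JointWalkExpansion` through `X` on the `R`-ball with drop `ε`, torus rate `κ`, constant
`3B + B′`, TWO terms. [cite: Balaban1988RG2Cluster, (1.11) p.5, p.13, (2.16) p.16; Balaban1985BackgroundPropagators, Thm 3.10 p.416] -/
theorem jointWalkExpansion_of_letters {c : B13.Consts} {locp : p → UT Nf} {locn : n → UT Nf}
    {K : (TPt d N' → ℂ) → E → Matrix p n ℂ} {X : Finset (UT Nf)} {R ε kap B B' : ℝ} (hX : X.Nonempty)
    (hL : KernelLetters c locp locn K X R (kap + ε) B B') (hkap : 0 ≤ kap) :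
    JointWalkExpansion c locp locn K X R ε kap (3 * B + B') (twoTerms K) {true} (ampl B B') (walkDist X)
      (kap + ε) where
  hasSum σ hσ u hu i j := by
    have h := hasSum_fintype (fun ω => twoTerms K ω σ u i j)
    have hs : ∑ ω, twoTerms K ω σ u i j = K σ u i j := by
      rw [Fintype.sum_bool]; simp only [twoTerms_true, twoTerms_false, Matrix.sub_apply, Matrix.add_apply]; ring
    rwa [hs] at h
  termAnalytic ω σ hσ i j := by
    cases ω
    · simp only [twoTerms_false, Matrix.add_apply, Matrix.sub_apply]
      exact ((hL.holo σ hσ i j).sub_const _).add_const _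
    · simp only [twoTerms_true]
      exact differentiableOn_const _
  maj ω σ hσ u hu i j := by
    have hR : 0 < R := lt_of_le_of_lt dist_nonneg (mem_ball.1 hu)
    have h0 : (0 : E) ∈ ball (0 : E) R := mem_ball_self hR
    cases ω
    · simp only [twoTerms_false, Matrix.add_apply, Matrix.sub_apply, ampl_false, walkDist_false]
      have h1 := hL.decay σ hσ u hu i j
      have h2 := hL.decay σ hσ 0 h0 i j
      have h3 := hL.decay 0 (zero_mem_polydisc c) 0 h0 i j
      calc ‖K σ u i j - K σ 0 i j + K 0 0 i j‖ ≤ ‖K σ u i j‖ + ‖K σ 0 i j‖ + ‖K 0 0 i j‖ :=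
            (norm_add_le _ _).trans (by gcongr; exact norm_sub_le _ _)
        _ ≤ 3 * B * Real.exp (-((kap + ε) * tdist1 Nf (locp i) (locn j))) := by linarith
    · simpa only [twoTerms_true, Matrix.sub_apply, ampl_true, walkDist_true] using hL.sigmaLoc σ hσ i j
  majSum S a b := by
    have hterm : ∀ ω, 0 ≤ ampl B B' ω * Real.exp (-((kap + ε - ε) * walkDist X ω a b)) := fun ω => by
      cases ω
      · exact mul_nonneg (by simp; linarith [hL.B_nonneg]) (Real.exp_nonneg _)
      · exact mul_nonneg (by simpa using hL.B'_nonneg) (Real.exp_nonneg _)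
    calc ∑ ω ∈ S, ampl B B' ω * Real.exp (-((kap + ε - ε) * walkDist X ω a b))
        ≤ ∑ ω, ampl B B' ω * Real.exp (-((kap + ε - ε) * walkDist X ω a b)) :=
          Finset.sum_le_sum_of_subset_of_nonneg (Finset.subset_univ S) fun ω _ _ => hterm ω
      _ = B' * Real.exp (-(kap * distX X a b)) + 3 * B * Real.exp (-(kap * tdist1 Nf a b)) := by
          rw [Fintype.sum_bool]; simp
      _ ≤ B' * Real.exp (-(kap * tdist1 Nf a b)) + 3 * B * Real.exp (-(kap * tdist1 Nf a b)) :=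
          add_le_add (mul_le_mul_of_nonneg_left
            (Real.exp_le_exp.2 (neg_le_neg (mul_le_mul_of_nonneg_left (tdist1_le_distX hX a b) hkap)))
            hL.B'_nonneg) le_rfl
      _ = (3 * B + B') * Real.exp (-(kap * tdist1 Nf a b)) := by ring
  indep ω hω σ hσ := by
    cases ω
    · simp
    · exact absurd (Set.mem_singleton true) hω
  through ω hω := by
    cases ω
    · simp at hω
    · intro y y'
      obtain ⟨z, hz, h⟩ := distX_eq hX y y'
      exact ⟨z, Finset.mem_coe.2 hz, by rw [walkDist_true, h]; exact le_rfl⟩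
  A_nonneg ω := by
    cases ω
    · simp; linarith [hL.B_nonneg]
    · simpa using hL.B'_nonneg
  D_nonneg ω a b := by
    cases ω
    · exact tdist1_nonneg a b
    · exact distX_nonneg X a b

omit [NormedSpace ℂ E] in
/-- **T-25.1′ — covariance slot**: letter (L4) (plain decay of a kernel family at rate `κ`, NO analyticity, NO
σ-structure) ⟹ `WalkMajorants` with ONE term (generic configuration space `E`; the tree's `walkMajorants_single` is the
case `E = ℂ`). [cite: Balaban1985BackgroundPropagators, (3.108) p.416; Balaban1988RG2Cluster, p.13] -/
theorem walkMajorants_of_decay (c : B13.Consts) (locp : p → UT Nf) (locn : n → UT Nf)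
    (K : (TPt d N' → ℂ) → E → Matrix p n ℂ) {R kap BC : ℝ} (hBC : 0 ≤ BC)
    (hbd : ∀ σ : TPt d N' → ℂ, (∀ j, ‖σ j‖ ≤ Real.exp c.κ₁) → ∀ u ∈ ball (0 : E) R,
      ∀ i j, ‖K σ u i j‖ ≤ BC * Real.exp (-(kap * tdist1 Nf (locp i) (locn j)))) :
    WalkMajorants c locp locn K R kap BC (fun (_ : Unit) σ u => K σ u) (fun _ => BC) (fun _ a b => tdist1 Nf a b) kap where
  hasSum σ _ u _ i j := hasSum_unique fun _ : Unit => K σ u i j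
  maj _ σ hσ u hu i j := hbd σ hσ u hu i j
  majSum S a b :=
    (Finset.sum_le_sum_of_subset_of_nonneg (Finset.subset_univ S)
      fun _ _ _ => mul_nonneg hBC (Real.exp_nonneg _)).trans_eq (by
        rw [Finset.sum_const, Finset.card_univ, Fintype.card_unit, one_nsmul])
  A_nonneg _ := hBC

/-! ## §3. One (2.14)-term and the exhausting family -/

variable {c : B13.Consts}

/-- **LETTERS OF ONE TERM** (named hypothesis shape): (L1)–(L3) for the Γ-kernel and for the precision at rate `ρ`,
(L4) for the inverse precision at rate `κ`, the geometric clause (L5), `X ≠ ∅`.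
[cite: Balaban1988RG2Cluster, p.13, p.15, (2.16) p.16] -/
structure TermLetters (𝒦 : TermKernels c d N' ν Nf E) (R ρ kap BΓ BΓ' BE BE' BC Rσ : ℝ) : Prop where
  nonempty : 𝒦.X.Nonempty
  hΓ : KernelLetters c 𝒦.locΛ 𝒦.locN 𝒦.G2 𝒦.X R ρ BΓ BΓ'
  hE : KernelLetters c 𝒦.locΛ 𝒦.locΛ 𝒦.A2 𝒦.X R ρ BE BE'
  hC : ∀ σ : TPt d N' → ℂ, (∀ j, ‖σ j‖ ≤ Real.exp c.κ₁) → ∀ u ∈ ball (0 : E) R,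
    ∀ i j, ‖(𝒦.A2 σ u)⁻¹ i j‖ ≤ BC * Real.exp (-(kap * tdist1 Nf (𝒦.locΛ i) (𝒦.locΛ j)))
  hBC : 0 ≤ BC
  hfar : ∀ b : 𝒦.Λ, ∀ z ∈ 𝒦.X, Rσ ≤ tdist1 Nf (𝒦.locΛ b) z

/-- The constant package read off the letters: `(R, ε := ρ − κ, κ, 3B_Γ + B′_Γ, 3B_E + B′_E, B_C, R_σ)`. [cite: Balaban1988RG2Cluster, p.13, p.15] -/
def lettersPackage (R ρ kap BΓ BΓ' BE BE' BC Rσ : ℝ) : WalkConsts :=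
  ⟨R, ρ - kap, kap, 3 * BΓ + BΓ', 3 * BE + BE', BC, Rσ⟩

/-- **T-25.2 — `TermWalkData` FROM LETTERS** (`0 ≤ κ`; the drop `ε = ρ − κ` is read off). [cite: Balaban1988RG2Cluster, p.13, p.15, (2.16) p.16] -/
theorem termWalkData_of_letters {𝒦 : TermKernels c d N' ν Nf E} {R ρ kap BΓ BΓ' BE BE' BC Rσ : ℝ}
    (h : TermLetters 𝒦 R ρ kap BΓ BΓ' BE BE' BC Rσ) (hkap : 0 ≤ kap) :
    TermWalkData 𝒦 (lettersPackage R ρ kap BΓ BΓ' BE BE' BC Rσ) := by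
  have hρ : ρ = kap + (ρ - kap) := by ring
  have hΓ' : KernelLetters c 𝒦.locΛ 𝒦.locN 𝒦.G2 𝒦.X R (kap + (ρ - kap)) BΓ BΓ' := hρ ▸ h.hΓ
  have hE' : KernelLetters c 𝒦.locΛ 𝒦.locΛ 𝒦.A2 𝒦.X R (kap + (ρ - kap)) BE BE' := hρ ▸ h.hE
  refine ⟨⟨Bool, twoTerms 𝒦.G2, {true}, ampl BΓ BΓ', walkDist 𝒦.X, kap + (ρ - kap), ?_⟩,
    ⟨Bool, twoTerms 𝒦.A2, {true}, ampl BE BE', walkDist 𝒦.X, kap + (ρ - kap), ?_⟩,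
    ⟨Unit, fun _ σ u => (𝒦.A2 σ u)⁻¹, fun _ => BC, fun _ a b => tdist1 Nf a b, kap, ?_⟩, h.hfar⟩
  · exact jointWalkExpansion_of_letters h.nonempty hΓ' hkap
  · exact jointWalkExpansion_of_letters h.nonempty hE' hkap
  · exact walkMajorants_of_decay c 𝒦.locΛ 𝒦.locΛ (fun σ u => (𝒦.A2 σ u)⁻¹) h.hBC h.hC

/-- **T-25.3 — NODE O's SHAPE FROM UNIFORM LETTERS**: one letter package `(R, ρ, κ, B_Γ, B′_Γ, B_E, B′_E, B_C, R_σ)`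
serving EVERY member and term of the exhausting family, with `0 < κ ≤ ρ`, `0 ≤ α < R`, `R_σ0 ≤ R_σ`, and the exchange
inequality `2K̄(e^{−(ρ−κ)R_σ} + α∕R) ≤ θ₀` for `K̄ = max(3B_Γ + B′_Γ, 3B_E + B′_E)` ⟹ `ExistsUniformAcrossSmall`
(by the tree's `acrossSmall_of_decay`).  The letters for Bałaban's operators are NOT supplied here.
[cite: Balaban1988RG2Cluster, (1.11) p.5, p.13, p.15; Balaban1985BackgroundPropagators, Thm 3.10 p.416] -/
theorem acrossSmall_of_letters {S : Type*} {𝓣 : S → TorusTerms c d}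
    {α Rσ₀ θ₀ R ρ kap BΓ BΓ' BE BE' BC Rσ : ℝ}
    (hall : ∀ s, ∀ i : (𝓣 s).ι, TermLetters ((𝓣 s).𝒦 i) R ρ kap BΓ BΓ' BE BE' BC Rσ)
    (hαR : α < R) (hα : 0 ≤ α) (hkap : 0 < kap) (hkρ : kap ≤ ρ) (hRσ : Rσ₀ ≤ Rσ)
    (hBΓ : 0 ≤ BΓ) (hBΓ' : 0 ≤ BΓ') (hBE : 0 ≤ BE) (hBE' : 0 ≤ BE') (hBC : 0 ≤ BC)
    (hθ : 2 * max (3 * BΓ + BΓ') (3 * BE + BE') * (Real.exp (-((ρ - kap) * Rσ)) + α / R) ≤ θ₀) :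
    ExistsUniformAcrossSmall 𝓣 α Rσ₀ θ₀ :=
  acrossSmall_of_decay (lettersPackage R ρ kap BΓ BΓ' BE BE' BC Rσ)
    ⟨hαR, sub_nonneg.2 hkρ, hkap, show 0 ≤ 3 * BΓ + BΓ' by linarith, show 0 ≤ 3 * BE + BE' by linarith, hBC, hRσ⟩
    (fun s i => termWalkData_of_letters (hall s i) hkap.le) (le_max_left _ _) (le_max_right _ _) hα hθ


/-! ## §4. T-25.4 / T-25.5 — the second-order (Agmon-type) Combes–Thomas bond inequality and its scaling

Why the STRUCTURED conjugation `e^{μφ} A e^{−μφ}` is k-uniform for second-order difference operators while the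
black-box bound `h(e^θ − 1) ≤ g/2` of `Literature.Analysis.Matrix.coercive_combes_thomas` is not: on ONE bond of
weight `w` with unitary phase `U`, the odd part of the conjugation is purely imaginary, so the real part of the
conjugated bond form loses only `w·(e^s + e^{−s} − 2)/2·(‖f‖² + ‖g‖²)` (T-25.4); with `w = η⁻²` and `|s| ≤ μη` this
loss is `≤ μ²(‖f‖² + ‖g‖²)`, INDEPENDENT of the lattice spacing `η` (T-25.5).  [folklore: Agmon 1982 / Combes–Thomas
1973, second-order form; the operator-level sum over bonds is bookkeeping and is NOT done here.]
NOT NEW relative to the memo's own record: the general graph / vector-fibre form of the same cancellation for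
complex link pairs `(W, W⁻¹)` is g5's companion `SketchSmallFieldTransfer.lean` §9–§13 (`pairing_defect_le`,
`holSesq_conj`, `conjAccretive_of_smallField_sharp`, `inv_decay_of_conjAccretive`; memo v3.9 l.535–541), the tree has
`Beta.CombesThomasForm.inv_sq_mul_cosh_sub_one_le` and `King1986.UniformDecay.form_conj_eq_cosh`, and the Gaps cell
has `D4WalkBlockCoerciveLetter.conjCoercive_of_hermitian_range_cosh`; this § only isolates the ONE-BOND identity
next to the interface theorem of §1–§3, for the reader of S25 (25-c (ii)). -/

open ComplexConjugate in
/-- **T-25.4 — conjugated bond form, real part.**  For `w ≥ 0`, `‖U‖ = 1`: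
`w(‖f‖² + ‖g‖² − 2 Re(U g f̄)) − w·(e^s + e^{−s} − 2)/2·(‖f‖² + ‖g‖²) ≤ Re[w(‖f‖² + ‖g‖² − e^s U g f̄ − e^{−s} Ū f ḡ)]` —
the one-bond form of the Combes–Thomas conjugation estimate. [cite: AizenmanWarzel2015, §10.3 (Combes–Thomas estimate); CombesThomas1973] -/
theorem re_conjBond_ge (w s : ℝ) (hw : 0 ≤ w) (U f g : ℂ) (hU : ‖U‖ = 1) :
    w * (‖f‖ ^ 2 + ‖g‖ ^ 2 - 2 * (U * g * conj f).re)
        - w * ((Real.exp s + Real.exp (-s) - 2) / 2) * (‖f‖ ^ 2 + ‖g‖ ^ 2)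
      ≤ ((w : ℂ) * ((((‖f‖ ^ 2 + ‖g‖ ^ 2 : ℝ)) : ℂ) - (Real.exp s : ℂ) * (U * g * conj f)
          - (Real.exp (-s) : ℂ) * (conj U * f * conj g))).re := by
  set z : ℂ := U * g * conj f with hz
  have hz' : conj U * f * conj g = conj z := by
    simp [hz, map_mul, mul_comm, mul_left_comm]
  have hre : ((w : ℂ) * ((((‖f‖ ^ 2 + ‖g‖ ^ 2 : ℝ)) : ℂ) - (Real.exp s : ℂ) * z
      - (Real.exp (-s) : ℂ) * conj z)).re
      = w * (‖f‖ ^ 2 + ‖g‖ ^ 2 - (Real.exp s + Real.exp (-s)) * z.re) := by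
    simp only [Complex.re_ofReal_mul, Complex.sub_re, Complex.ofReal_re, Complex.conj_re]
    ring
  rw [hz', hre]
  -- `Re z ≤ ‖f‖‖g‖ ≤ (‖f‖² + ‖g‖²)/2`
  have hzle : z.re ≤ (‖f‖ ^ 2 + ‖g‖ ^ 2) / 2 := by
    have h1 : z.re ≤ ‖z‖ := Complex.re_le_norm z
    have h2 : ‖z‖ = ‖g‖ * ‖f‖ := by simp [hz, hU]
    nlinarith [sq_nonneg (‖f‖ - ‖g‖), norm_nonneg f, norm_nonneg g]
  -- `e^s + e^{-s} - 2 ≥ 0`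
  have hc : 0 ≤ Real.exp s + Real.exp (-s) - 2 := by
    have he := Real.exp_pos s
    have hmul : Real.exp s * (Real.exp s + Real.exp (-s) - 2) = (Real.exp s - 1) ^ 2 := by
      rw [Real.exp_neg]; field_simp; ring
    have h0 : Real.exp s * 0 ≤ Real.exp s * (Real.exp s + Real.exp (-s) - 2) := by
      rw [mul_zero, hmul]; positivity
    exact le_of_mul_le_mul_left h0 he
  have h3 : 0 ≤ w * (Real.exp s + Real.exp (-s) - 2) * ((‖f‖ ^ 2 + ‖g‖ ^ 2) / 2 - z.re) :=
    mul_nonneg (mul_nonneg hw hc) (sub_nonneg.2 hzle)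
  nlinarith [h3]

/-- **T-25.5 — the scaling that makes it k-uniform.**  With bond weight `η⁻²` and conjugation exponent `|μη| ≤ 1`:
`η⁻²·(e^{μη} + e^{−μη} − 2) ≤ 2μ²` — no `η` left.  (Uses Mathlib's `Real.abs_exp_sub_one_sub_id_le`.) [cite: AizenmanWarzel2015, §10.3 (Combes–Thomas estimate)] -/
theorem conjError_scale (μ η : ℝ) (hη : 0 < η) (h : |μ * η| ≤ 1) :
    η⁻¹ ^ 2 * (Real.exp (μ * η) + Real.exp (-(μ * η)) - 2) ≤ 2 * μ ^ 2 := by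
  have h1 : Real.exp (μ * η) - 1 - μ * η ≤ (μ * η) ^ 2 :=
    (le_abs_self _).trans (Real.abs_exp_sub_one_sub_id_le h)
  have h2 : Real.exp (-(μ * η)) - 1 - (-(μ * η)) ≤ (-(μ * η)) ^ 2 :=
    (le_abs_self _).trans (Real.abs_exp_sub_one_sub_id_le (by simpa using h))
  have h12 : Real.exp (μ * η) + Real.exp (-(μ * η)) - 2 ≤ 2 * (μ * η) ^ 2 := by nlinarith
  have hη2 : 0 ≤ η⁻¹ ^ 2 := by positivity
  calc η⁻¹ ^ 2 * (Real.exp (μ * η) + Real.exp (-(μ * η)) - 2)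
      ≤ η⁻¹ ^ 2 * (2 * (μ * η) ^ 2) := mul_le_mul_of_nonneg_left h12 hη2
    _ = 2 * μ ^ 2 := by field_simp

end Literature.MathematicalPhysics.QuantumFieldTheory.Balaban1983to89.NodeOLetters

end
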